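/-
COR-CM (cell pub-hodgecm2, stage 2 of the Hodge ladder) — count-neutral KERNEL COMBINATORICS «field level of the inversion-type census: every DIHEDRAL and
every DICYCLIC (generalised quaternion) Galois CM field of any degree 4n ≥ 8 has EXACTLY φ₂(F) generating faces — one theorem» (seat
prover-pub-hodgecm2-b23-g50-0, binder prover b23, gen 50; own census lane INDEX-TWO CYCLIC 2-GROUPS, claim HOME/INBOX.md l.23042, INTERIM #1 l.23124).
Theorems only; `Census/IndexTwoCyclicInversion.lean` (this seat), the field transfer, gen 49ʼs `Aut(F) ≃* GalT F` dictionary and the INT2-GEN socket are used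
BY NAME; nothing asserted.  `Interfaces.lean` (C1), every E term, B01, `Transposition/*`, `PortJoin/*`, `D2Bridge/*` untouched.
HONEST FRAMING: `HC_CM` is NOT proved, here or anywhere in the tree; this file produces no period and proves no face period for any field; §2 is
CONDITIONAL on the face periods exactly as the earlier sockets.
T5: n/a-class (hypothesis binders: `[F:ℚ] = 4n`, `n ≥ 2`, `u₀ ∈ Aut F` of order `2n` with `u₀ⁿ` inducing complex conjugation at `σ₀`, `w₀ ∉ ⟨u₀⟩` with
`w₀ u₀ w₀⁻¹ = u₀⁻¹` — inhabited by the dihedral and dicyclic CM closures; checker: self, 2026-08-25).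
-/
import Summits.HodgeConjecture.CorCM.Census.IndexTwoCyclicInversion
import Summits.HodgeConjecture.CorCM.FaceIndexTwoCyclicTwoGroups
import HarnessLib

/-!
# Field level: dihedral and dicyclic Galois CM fields of every degree

A Galois CM field `F` of degree `4n ≥ 8` with an automorphism `u₀` of order `2n` whose `n`-th power is complex conjugation (at `σ₀`) and an
automorphism `w₀ ∉ ⟨u₀⟩` INVERTING `u₀` has Galois group `D_{4n}` (if `w₀² = 1`) or `Q_{4n}` (if `w₀² = u₀ⁿ`) — `Census/IndexTwoCyclicInversion.lean`
shows these are the only possibilities and that the face census closes in both: 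

* §1 **`isLeast_card_faces_hgen_of_inverting (h2) (u w : GalT F) (hun) (hord) (hindex) (hw) (hwu) (σ₀)`** (intrinsic) and
  **`isLeast_card_faces_hgen_of_aut_inverting (σ₀) (u₀ w₀)
  (h2 : 2 ≤ n) (hord : orderOf u₀ = 2n) (hcσ : σ₀ ∘ u₀ⁿ = conj ∘ σ₀) (hw : w₀ ∉ ⟨u₀⟩) (hwu : w₀ u₀ w₀⁻¹ = u₀⁻¹) (hdeg : [F:ℚ] = 4n)`**: EXACTLY `φ₂(F)`
  generating faces — every dihedral CM field (seat b23 gen 48, datum form) and every dicyclic / generalised-quaternion CM field (NEW at field level for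
  even `n`: seat b09ʼs column is stated on Mathlibʼs concrete `QuaternionGroup n`) in ONE theorem.
* §2 the CONDITIONAL Hodge-conjecture reading through the INT2-GEN socket.  `HC_CM` is NOT proved.

## References
* [Pohlmann1968] H. Pohlmann, Algebraic cycles on abelian varieties of complex multiplication type, Ann. of Math. 88 (1968), Thm 1.
* [Shimura1998] G. Shimura, Abelian Varieties with Complex Multiplication and Modular Functions, §6.2 Thm. 3, §8.1.
-/

noncomputable section

open CategoryTheory NumberField NumberField.ComplexEmbedding
open Literature.AlgebraicGeometry Literature.AlgebraicGeometry.Motives Literature.AlgebraicGeometry.HodgeTheory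
open Literature.AlgebraicGeometry.ComplexMultiplication Literature.AlgebraicGeometry.Milne1999
open Literature.NumberTheory.Automorphic
open Literature.NumberTheory.Automorphic.PicardCM
open Summit.HodgeConjecture.CorCM.Domination

namespace Summit.HodgeConjecture.CorCM.FaceIndexTwoCyclic

open Summit.HodgeConjecture.CorCM.Prior.AllgGroup.RfwfAllgGroup
open Summit.HodgeConjecture.CorCM.Census.BlockParity
open Summit.HodgeConjecture.CorCM.Census.Coinvariant
open Summit.HodgeConjecture.CorCM.Census
open Summit.HodgeConjecture.CorCM.FaceCensus.OddSlice (galTOfAut galTOfAut_mul galTOfAut_conjAut)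

section Field

variable {F : Type} [Field F] [NumberField F]

/-! ## §1 Exactly `φ₂(F)` generating faces -/

/-- **INVERSION TYPE, INTRINSIC FORM**: `u ∈ GalT F` of order `2n` (`n ≥ 2`) with `uⁿ = conjT`, `[GalT F : ⟨u⟩] = 2`, and `w ∉ ⟨u⟩` inverting `u` ⟹
EXACTLY `φ₂(F)` generating faces. [folklore] -/
theorem isLeast_card_faces_hgen_of_inverting [IsCMField F] [IsGalois ℚ F] {n : ℕ} (h2 : 2 ≤ n) (u w : GalT F) (hun : u ^ n = conjT)
    (hord : orderOf u = 2 * n) (hindex : (Subgroup.zpowers u).index = 2) (hw : w ∉ Subgroup.zpowers u) (hwu : w * u * w⁻¹ = u⁻¹)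
    (σ₀ : F →+* ℂ) :
    IsLeast {m : ℕ | ∃ 𝒮 : Finset (Face F), 𝒮.card = m ∧
      ∀ f : Face F, lefChar f.corner (fun _ => ({σ₀} : Finset (F →+* ℂ))) ∈ AddSubgroup.closure
        {a : Asym F | ∃ g ∈ (𝒮 : Set (Face F)), ∃ σ : F →+* ℂ, a = lefChar g.corner (fun _ => ({σ} : Finset (F →+* ℂ)))}}
      (fibreTwo (conjT : GalT F) conjT_mul_self) := by
  refine FaceTransfer.isLeast_card_faces_hgen_of_intrinsic _ ?_ (fun S₀ hS₀ hS => ?_) σ₀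
  · obtain ⟨S, hS, hcard', hgen⟩ := (IndexTwoCyclic.isLeast_card_gfaces_generate_fibreTwo_of_inverting conjT_mul_self conjT_ne_one u w h2 hun
      hord hindex hw hwu).1
    exact ⟨S, hS, hcard'.le, hgen⟩
  · exact fibreTwo_le_card conjT conjT_mul_self FaceBasis.conjT_comm S₀ (Submodule.span ℤ (pairSet conjT)) le_rfl hS₀
      (fun y hy => hS (gfaceSet_subset_hodgeSpan conjT conjT_mul_self hy))

/-- **EVERY DIHEDRAL AND EVERY DICYCLIC GALOIS CM FIELD HAS EXACTLY `φ₂(F)` GENERATING FACES** (`Aut` form): `[F:ℚ] = 4n` (`n ≥ 2`), `u₀ ∈ Aut F` of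
order `2n` with `u₀ⁿ` inducing complex conjugation at `σ₀`, and `w₀ ∉ ⟨u₀⟩` with `w₀ u₀ w₀⁻¹ = u₀⁻¹` (then `w₀² = 1`: `Gal ≅ D_{4n}`, or `w₀² = u₀ⁿ`:
`Gal ≅ Q_{4n}`). [folklore] -/
theorem isLeast_card_faces_hgen_of_aut_inverting [IsCMField F] [IsGalois ℚ F] (σ₀ : F →+* ℂ) {n : ℕ} (h2 : 2 ≤ n) (u₀ w₀ : F ≃ₐ[ℚ] F)
    (hord : orderOf u₀ = 2 * n) (hcσ : σ₀.comp ((u₀ ^ n : F ≃ₐ[ℚ] F) : F →+* F) = conjugate σ₀) (hw : w₀ ∉ Subgroup.zpowers u₀)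
    (hwu : w₀ * u₀ * w₀⁻¹ = u₀⁻¹) (hdeg : Module.finrank ℚ F = 4 * n) :
    IsLeast {m : ℕ | ∃ 𝒮 : Finset (Face F), 𝒮.card = m ∧
      ∀ f : Face F, lefChar f.corner (fun _ => ({σ₀} : Finset (F →+* ℂ))) ∈ AddSubgroup.closure
        {a : Asym F | ∃ g ∈ (𝒮 : Set (Face F)), ∃ σ : F →+* ℂ, a = lefChar g.corner (fun _ => ({σ} : Finset (F →+* ℂ)))}}
      (fibreTwo (conjT : GalT F) conjT_mul_self) := by
  set e : (F ≃ₐ[ℚ] F) ≃* GalT F := MulEquiv.mk' (galTOfAut σ₀) (galTOfAut_mul σ₀) with he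
  have he_apply : ∀ x, e x = galTOfAut σ₀ x := fun x => rfl
  have hord' : orderOf (e u₀) = 2 * n := by
    rw [← hord]; exact orderOf_injective e.toMonoidHom e.injective u₀
  have hindex : (Subgroup.zpowers (e u₀)).index = 2 := by
    have h := (Subgroup.zpowers (e u₀)).card_mul_index
    rw [Nat.card_zpowers, hord', Nat.card_eq_fintype_card, FaceCensus.card_galT, hdeg] at h
    have e2 : 2 * n * (Subgroup.zpowers (e u₀)).index = 2 * n * 2 := by rw [h]; ring
    exact Nat.eq_of_mul_eq_mul_left (by omega) e2
  have hun : e u₀ ^ n = conjT := by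
    rw [← map_pow, he_apply]
    exact galTOfAut_conjAut σ₀ hcσ
  have hw' : e w₀ ∉ Subgroup.zpowers (e u₀) := by
    rw [← MonoidHom.coe_coe, ← MonoidHom.map_zpowers]
    rintro ⟨x, hx, hxe⟩
    exact hw (by rwa [← e.injective hxe])
  have hwu' : e w₀ * e u₀ * (e w₀)⁻¹ = (e u₀)⁻¹ := by rw [← map_mul, ← map_inv, ← map_mul, hwu, map_inv]
  exact isLeast_card_faces_hgen_of_inverting h2 (e u₀) (e w₀) hun hord' hindex hw' hwu' σ₀

/-- `[F:ℚ] = 4n ≥ 8 ≥ 6` for `n ≥ 2`. [folklore] -/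
theorem six_le_finrank_of_four_mul {n : ℕ} (hdeg : Module.finrank ℚ F = 4 * n) (h2 : 2 ≤ n) : 6 ≤ Module.finrank ℚ F := by
  rw [hdeg]; omega

end Field

/-! ## §2 The Hodge-conjecture reading through the INT2-GEN socket (conditional on the face periods) -/

/-- **HC for the slice of every dihedral / dicyclic Galois CM field of degree `4n ≥ 8`, from `φ₂(K)` face periods** (INT2-GEN socket BY NAME;
CONDITIONAL on the periods — `HC_CM` is NOT proved). [cite: Shimura1998, §6.2 Theorem 3 and §6.1 Corollary of Theorem 2 (pp. 41–43)]
[cite: Pohlmann1968, Thm. 1] [cite: Milne1999LefschetzClasses, Thm. 3.2 and Cor. 4.5] [cite: MumfordAV1970, §19 Thm. 1 and p. 169] -/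
theorem hodgeConjectureFor_of_aut_inverting_of_exists_facePeriod (K : CMField) [hGal : IsGalois ℚ K] (σ₀ : (K : Type) →+* ℂ) {n : ℕ}
    (h2 : 2 ≤ n) (u₀ w₀ : (K : Type) ≃ₐ[ℚ] (K : Type)) (hord : orderOf u₀ = 2 * n)
    (hcσ : σ₀.comp ((u₀ ^ n : (K : Type) ≃ₐ[ℚ] (K : Type)) : (K : Type) →+* (K : Type)) = conjugate σ₀)
    (hw : w₀ ∉ Subgroup.zpowers u₀) (hwu : w₀ * u₀ * w₀⁻¹ = u₀⁻¹) (hdeg : Module.finrank ℚ K = 4 * n) :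
    ∃ 𝒮 : Finset (Face K), 𝒮.card = fibreTwo (conjT : GalT K) conjT_mul_self ∧
      ((∀ f ∈ 𝒮, ∃ ι₁ : K →+* ℂ, f.Admissible ι₁ ∧ ∃ (V : HermSpace3 K ι₁) (σ : K →+* ℂ),
        (Model.picardCMUniverse exists_isReal_hodgeModel_holds hodgePQ_independent_of_hodgeModel_holds
          BallQuotient.ballQuotientUniformised_holds cmAbelianVarietyRealised_holds).PeriodNV ι₁ V K f.psi σ) →
      ∀ {P B : AbelianVariety ℂ}, AbelianVariety.IsProductOf (fun B : AbelianVariety ℂ =>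
        ∃ (E : Type) (_ : Field E) (_ : NumberField E) (_ : IsCMField E) (_ : E →+* (K : Type)) (Φ : CMType E)
          (ι : 𝓞 E →+* End B) (ϑ : E →+* Module.End ℂ (complexBetti B.X 1)),
          IsCMTypeRealisation Φ B ι ϑ) P →
      AVDominatedBy B P → HodgeConjectureFor B.dim B.X) := by
  obtain ⟨⟨𝒮, hcard, hgen⟩, -⟩ := isLeast_card_faces_hgen_of_aut_inverting (F := K) σ₀ h2 u₀ w₀ hord hcσ hw hwu hdeg
  refine ⟨𝒮, hcard, fun h P B hP hB => ?_⟩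
  exact hodgeConjectureFor_of_avDominatedBy_isProductOf_of_exists_facePeriod_on K (six_le_finrank_of_four_mul (F := K) hdeg h2)
    (𝒮 : Set (Face K)) σ₀ hgen (fun f hf => h f (Finset.mem_coe.mp hf)) hP hB

end Summit.HodgeConjecture.CorCM.FaceIndexTwoCyclic
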